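import Literature.NumberTheory.Rogawski1990.FinExplicitTransferFactorFormTransport   -- ★ non-split chain `finsum_finExplicitDelta_mul_classOrbitalIntegral_transport`; brings ★ `…ConjRight`, ★ `DeltaTransferTransport`, ★ `LocalTransferTransport`, ★ `LocalUnitaryGroupSimilitude`
import Literature.NumberTheory.Rogawski1990.FinExplicitTransferFactorGHRegular        -- ★ `isUnit_eval_finCharpolyTwo_of_isLocalGRegular`
import Literature.NumberTheory.Rogawski1990.CharIdentityOnTestFunctionsFormSign       -- ★ `clauseSign_eq_intCast_formSignAt`, `intCast_formSignAt_eq_one_of_split`; brings ★ `formSignAt`, ★ `PlacesOver.galInv_ne`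
import Literature.NumberTheory.Rogawski1990.LocalTransferExistence                     -- ★ `IsLocalDeltaTransferExists`
import Literature.NumberTheory.Automorphic.LocalStableOrbitalFinite                   -- ★ `stableOrbitalIntegralRel_smul_fun`
import HarnessLib

/-!
# R90 · S3 — (4.9.1)-matchings transport along a local similitude frame AT EVERY FINITE PLACE (split places included), with the form sign `ε_v(H)`

R90-TF section S3 (dealer R90-C12-plan (g0)), hand p06 «A1-split», payer file (R-i) of RULING S3-R5 ∕ AUDIT S3#12 (2026-09-04): the tree's
`Lines/R90_S3_CharIdTransportB` §1 `isLocalDeltaTransfer_finExplicit_transport_iff` transports `Δ‴`-matchings along the frame of record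
`e_v = cmDatumLocalCongr L v T ha h : U(Φ₃)_v ≃ₜ* U(H)_v` under the NON-SPLIT guard `hv` (the sign `χ(a)` is read through ★
`finKappaAt_cmDatumLocalCongr_symm`, which needs the one place `w ∣ v`).  This file removes the guard:

* §1 `finEigenlineProjector_cmDatumLocalCongr_symm` — `P_v^{Φ₃}(γ_H, e_v⁻¹γ′) = T⁻¹ · P_v^{H}(γ_H, γ′) · T` (any `v`; `P_v` is a polynomial in `γ′`).
* §2 `finKappaAt_cmDatumLocalCongr_symm_of_split` — at a SPLIT `v` (two places above `v`) `κ_v ≡ 1` on the support of `P_v` (★ `finKappaAt_of_not_subsingleton`),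
  so `κ_v^{Φ₃}(γ_H, e_v⁻¹γ′) = κ_v^{H}(γ_H, γ′)`; §3 `finExplicitDelta_cmDatumLocalCongr_symm_of_split` — `Δ‴_v^{Φ₃}(γ_H, e_v⁻¹γ′) = Δ‴_v^{H}(γ_H, γ′)`
  (`τ_v`, `D_v` see `γ_H` only; matching pairs correspond along the class-preserving `e_v`, ★ `isLocalNormPair_iff_comp_of_corresponds`).
* §4 `finsum_finExplicitDelta_mul_classOrbitalIntegral_transport_of_split` — the `Δ‴`-weighted orbital sums transport along `e_v` with factor `1`
  (reindex the classes along `e_v`, ★ `preClass` ∕ `classOrbitalIntegral_transport`, exactly as ★ `finsum_finExplicitDelta_mul_classOrbitalIntegral_transport`).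
* §5 `isLocalDeltaTransfer_finExplicit_transport_iff_of_split` — (R-i) AT A SPLIT PLACE, sign `+1`: `(f^H, g)` is `Δ‴^{H}`-matched for `(m_H, m′_G)` iff
  `(f^H, g ∘ e_v)` is `Δ‴^{Φ₃}`-matched for `(m_H, (e_v⁻¹)_* m′_G)`; the one-way form `isLocalDeltaTransfer_finExplicit_transport_of_split` is the `htr` input of
  `Lines/R90_S3_CharIdTransportB` ED. 2 §5 `kt2Clause_split_of_transport_of_isEndoExpansion` BY SHAPE.
* §6 `isLocalDeltaTransfer_finExplicit_transport_iff_formSignAt` — ONE STATEMENT FOR EVERY FINITE `v`, NO GUARD: the sign is the form sign `ε_v(H) = formSignAt L c H v`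
  (★ `clauseSign_eq_intCast_formSignAt` at non-split `v`, ★ `intCast_formSignAt_eq_one_of_split` at split `v`) — the shape AUDIT S3#12 asks for («keep the sign symbol
  so one statement serves split and non-split»); the companion file `R90S3SplitTransferExistsTransport` carries Prop. 4.9.1 (a) on `C_c^∞` along the frame, every `v`.

Print: at a place `v` of `F = L⁺` split in `E = L` the endoscopic character `κ` is trivial on the (`G`-regular) matching pairs («`κ(γ, ψ_v(i(γ)))` … is `+1` for almost
all `v`», §14.6 p. 242; `H¹(F_v, T) = 0` on the degree-one factor) and `Δ_{G/H} = τ·D_{G/H}` (§4.9 p. 55) does not see the hermitian form, so the frame change is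
sign-free there; at a non-split `v` the sign is the Kottwitz–Langlands–Shelstad invariant `χ(a) = ε_v(H)` of the inner twist (★ `FinExplicitTransferFactorFormTransport`).
Imports ★ Literature only (R-S3-1: no `Lines` file).  HONEST LABEL: transport book-keeping at the finite places — nothing printed in Ch. 13 is proved here; HC_CM is proved
only modulo the 7 printed citations (2 remaining named inputs: hLiu418 = stmt-HodgeConjecture-24832, h413 = stmt-HodgeConjecture-24833) until rung 0 closes; REL ≠ ★ ≠ BUILT.
-/

set_option autoImplicit false
set_option linter.dupNamespace false

noncomputable section

namespace Summit.HodgeConjecture.HodgeConjecture.R90.S3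

open MeasureTheory IsDedekindDomain NumberField Matrix
open Literature.NumberTheory Literature.NumberTheory.Automorphic Literature.NumberTheory.Automorphic.UnitaryGroup
open Literature.NumberTheory.Rogawski1990 Literature.NumberTheory.GaloisRepresentations
open scoped MatrixGroups

variable (L : Type) [Field L] [NumberField L] [IsCMField L] (v : HeightOneSpectrum (𝓞 ↥(maximalRealSubfield L)))
  (H : Matrix (Fin 3) (Fin 3) L) (T : GL (Fin 3) (UnitaryGroup.LocalRing L v)) {a : UnitaryGroup.LocalRing L v} (ha : IsUnit a)
  (h : formCongr (UnitaryGroup.conjLocal L (IsCMField.complexConj L) v) T (H.map (algebraMap L (UnitaryGroup.LocalRing L v))) =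
    a • (Matrix.of fun i j : Fin 3 => if i.val + j.val + 1 = 3 then (1 : L) else 0).map (algebraMap L (UnitaryGroup.LocalRing L v)))

/-! ## §0 Matrix book-keeping (generic) -/

/-- `T · T⁻¹ = 1` in `M₃` (bookkeeping). [folklore] -/
private theorem val_mul_val_inv {R : Type*} [CommRing R] (T : GL (Fin 3) R) :
    (T.val : Matrix (Fin 3) (Fin 3) R) * (T⁻¹ : GL (Fin 3) R).val = 1 := by
  rw [← Units.val_mul, mul_inv_cancel, Units.val_one]

/-- `T⁻¹ · T = 1` in `M₃` (bookkeeping). [folklore] -/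
private theorem val_inv_mul_val {R : Type*} [CommRing R] (T : GL (Fin 3) R) :
    ((T⁻¹ : GL (Fin 3) R).val : Matrix (Fin 3) (Fin 3) R) * T.val = 1 := by
  rw [← Units.val_mul, inv_mul_cancel, Units.val_one]

/-- `(c ι c′)² − t·(c ι c′) + d·1 = c (ι² − t·ι + d·1) c′` when `c′c = 1 = cc′` — a polynomial in a matrix transports under conjugation. [folklore] -/
private theorem conj_sq_sub_smul_add_smul_one {m : Type*} [Fintype m] [DecidableEq m] {R : Type*} [CommRing R] (c c' ι : Matrix m m R) (t d : R)
    (h1 : c' * c = 1) (h2 : c * c' = 1) :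
    c * ι * c' * (c * ι * c') - t • (c * ι * c') + d • (1 : Matrix m m R) = c * (ι * ι - t • ι + d • 1) * c' := by
  have hsq : c * ι * c' * (c * ι * c') = c * (ι * ι) * c' := by
    calc c * ι * c' * (c * ι * c') = c * ι * (c' * c) * ι * c' := by simp only [Matrix.mul_assoc]
      _ = c * (ι * ι) * c' := by rw [h1, Matrix.mul_one, Matrix.mul_assoc c ι ι]
  rw [hsq]
  simp only [Matrix.mul_sub, Matrix.mul_add, Matrix.sub_mul, Matrix.add_mul, Matrix.mul_smul, Matrix.smul_mul, Matrix.mul_one, h2]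

/-- A conjugate `c P c′` vanishes iff `P` does, when `c′ c = 1`. [folklore] -/
private theorem conj_eq_zero_iff {m : Type*} [Fintype m] [DecidableEq m] {R : Type*} [CommRing R] (c c' P : Matrix m m R)
    (h1 : c' * c = 1) : c * P * c' = 0 ↔ P = 0 := by
  constructor
  · intro h0
    calc P = (c' * c) * P * (c' * c) := by rw [h1, Matrix.one_mul, Matrix.mul_one]
      _ = c' * (c * P * c') * c := by simp only [Matrix.mul_assoc]
      _ = 0 := by rw [h0, Matrix.mul_zero, Matrix.zero_mul]
  · intro h0
    rw [h0, Matrix.mul_zero, Matrix.zero_mul]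

/-! ## §1 `P_v` along the frame (any finite `v`) -/

/-- **`P_v^{Φ₃}(γ_H, e_v⁻¹γ′) = T⁻¹ · P_v^{H}(γ_H, γ′) · T`**: `P_v(γ_H, γ′) = γ′² − tr(g)·γ′ + det(g)·1` is a polynomial in the matrix of `γ′` with scalar
coefficients read off `γ_H` (★ `finEigenlineProjector`), and `e_v⁻¹γ′ = T⁻¹γ′T` (★ `coe_cmDatumLocalCongr_apply`). [cite: Rogawski1990, §4.9 p. 55; §14.4 p. 237] -/
theorem finEigenlineProjector_cmDatumLocalCongr_symm
    (γH : (UnitaryGroup.cmDatum L 2 (Matrix.of fun i j : Fin 2 => if i.val + j.val + 1 = 2 then (1 : L) else 0)).Local v ×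
      (UnitaryGroup.cmDatum L 1 (Matrix.of fun i j : Fin 1 => if i.val + j.val + 1 = 1 then (1 : L) else 0)).Local v)
    (b : (UnitaryGroup.cmDatum L 3 H).Local v) :
    finEigenlineProjector L v (Matrix.of fun i j : Fin 3 => if i.val + j.val + 1 = 3 then (1 : L) else 0) γH
        ((UnitaryGroup.cmDatumLocalCongr L v T ha h).symm b) =
      ((T⁻¹ : GL (Fin 3) (UnitaryGroup.LocalRing L v)).val : Matrix (Fin 3) (Fin 3) (UnitaryGroup.LocalRing L v)) *
        finEigenlineProjector L v H γH b * (T.val : Matrix (Fin 3) (Fin 3) (UnitaryGroup.LocalRing L v)) := by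
  have hcoe : ((UnitaryGroup.cmDatumLocalCongr L v T ha h).symm b).val = T⁻¹ * b.val * T := rfl
  dsimp only [finEigenlineProjector]
  rw [hcoe, Units.val_mul, Units.val_mul]
  exact conj_sq_sub_smul_add_smul_one _ _ _ _ _ (val_mul_val_inv T) (val_inv_mul_val T)

/-! ## §2 `κ_v` along the frame at a SPLIT place: no sign -/

variable {L v} in
/-- Two places above `v` ⇒ the fibre is not a subsingleton (★ `PlacesOver.galInv_ne`). [cite: Rogawski1990, §14.6 p. 242] -/
private theorem not_subsingleton_placesOver_of_split' (hs : ∃ w : UnitaryGroup.PlacesOver L v, IsCMField.complexConj L • w.1 ≠ w.1) :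
    ¬ Subsingleton (UnitaryGroup.PlacesOver L v) := by
  obtain ⟨w, hw⟩ := hs
  exact fun _ => UnitaryGroup.PlacesOver.galInv_ne (IsCMField.complexConj L) w hw (Subsingleton.elim _ _)

open scoped Classical in
/-- **`κ_v^{Φ₃}(γ_H, e_v⁻¹γ′) = κ_v^{H}(γ_H, γ′)` AT A SPLIT PLACE**: with two places above `v`, `κ_v` is `1` on the support of `P_v` and `0` off it (★ `finKappaAt`,
`finKappaAt_of_not_subsingleton`, `finKappaAt_of_projector_eq_zero`), and the supports correspond (§1: `P_v` transports by the invertible conjugation `T⁻¹ · T`).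
[cite: Rogawski1990, §14.6 p. 242; §4.3 p. 43] [cite: LanglandsShelstad1987, §2] -/
theorem finKappaAt_cmDatumLocalCongr_symm_of_split (hs : ∃ w : UnitaryGroup.PlacesOver L v, IsCMField.complexConj L • w.1 ≠ w.1)
    (γH : (UnitaryGroup.cmDatum L 2 (Matrix.of fun i j : Fin 2 => if i.val + j.val + 1 = 2 then (1 : L) else 0)).Local v ×
      (UnitaryGroup.cmDatum L 1 (Matrix.of fun i j : Fin 1 => if i.val + j.val + 1 = 1 then (1 : L) else 0)).Local v)
    (b : (UnitaryGroup.cmDatum L 3 H).Local v) :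
    finKappaAt L v (Matrix.of fun i j : Fin 3 => if i.val + j.val + 1 = 3 then (1 : L) else 0) γH ((UnitaryGroup.cmDatumLocalCongr L v T ha h).symm b) =
      finKappaAt L v H γH b := by
  have hns := not_subsingleton_placesOver_of_split' hs
  have hP := finEigenlineProjector_cmDatumLocalCongr_symm L v H T ha h γH b
  -- the supports correspond
  have hiff : finEigenlineProjector L v (Matrix.of fun i j : Fin 3 => if i.val + j.val + 1 = 3 then (1 : L) else 0) γH
        ((UnitaryGroup.cmDatumLocalCongr L v T ha h).symm b) = 0 ↔ finEigenlineProjector L v H γH b = 0 := by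
    rw [hP]
    exact conj_eq_zero_iff _ _ _ (val_mul_val_inv T)
  by_cases hb : finEigenlineProjector L v H γH b = 0
  · rw [finKappaAt_of_projector_eq_zero L v H γH hb, finKappaAt_of_projector_eq_zero L v _ γH (hiff.2 hb)]
  · rw [finKappaAt_of_not_subsingleton L v H γH hb hns, finKappaAt_of_not_subsingleton L v _ γH (fun h0 => hb (hiff.1 h0)) hns]

/-! ## §3 `Δ‴_v` along the frame at a SPLIT place -/

open scoped Classical in
/-- **`Δ‴_v^{Φ₃}(γ_H, e_v⁻¹γ′) = Δ‴_v^{H}(γ_H, γ′)` AT A SPLIT PLACE** (every `γ_H`, every `γ′`): off the matching pairs both sides vanish (matching is conjugacy with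
`ι_v(γ_H)` in the common `GL₃(E_v)` and `e_v` is class-preserving, ★ `isLocalNormPair_iff_comp_of_corresponds` ∕ ★ `corresponds_cmDatumLocalCongr_symm`); on them
`Δ‴_v = τ_v·D_v·κ_v` with `τ_v`, `D_v` functions of `γ_H` alone and `κ_v` sign-free at a split place (§2). [cite: Rogawski1990, §4.9 p. 55; §4.3 (4.3.2) p. 43; §14.6 p. 242] -/
theorem finExplicitDelta_cmDatumLocalCongr_symm_of_split (hs : ∃ w : UnitaryGroup.PlacesOver L v, IsCMField.complexConj L • w.1 ≠ w.1) (μ : HeckeCharacter L)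
    (γH : (UnitaryGroup.cmDatum L 2 (Matrix.of fun i j : Fin 2 => if i.val + j.val + 1 = 2 then (1 : L) else 0)).Local v ×
      (UnitaryGroup.cmDatum L 1 (Matrix.of fun i j : Fin 1 => if i.val + j.val + 1 = 1 then (1 : L) else 0)).Local v)
    (b : (UnitaryGroup.cmDatum L 3 H).Local v) :
    finExplicitDelta L v (Matrix.of fun i j : Fin 3 => if i.val + j.val + 1 = 3 then (1 : L) else 0) γH μ ((UnitaryGroup.cmDatumLocalCongr L v T ha h).symm b) =
      finExplicitDelta L v H γH μ b := by
  classical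
  have hcl : ∀ γ' : (UnitaryGroup.cmDatum L 3 H).Local v,
      Corresponds (UnitaryGroup.conjLocal L (IsCMField.complexConj L) v) ((UnitaryGroup.adelicForm L 3 H).map (UnitaryGroup.adeleToLocal L v))
        ((UnitaryGroup.adelicForm L 3 (Matrix.of fun i j : Fin 3 => if i.val + j.val + 1 = 3 then (1 : L) else 0)).map (UnitaryGroup.adeleToLocal L v))
        γ' ((UnitaryGroup.cmDatumLocalCongr L v T ha h).symm γ') :=
    fun γ' => corresponds_comm.1 (corresponds_cmDatumLocalCongr_symm L v T ha h γ')
  by_cases hb : IsLocalNormPair L H v γH b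
  · have hb₀ : IsLocalNormPair L (Matrix.of fun i j : Fin 3 => if i.val + j.val + 1 = 3 then (1 : L) else 0) v γH
        ((UnitaryGroup.cmDatumLocalCongr L v T ha h).symm b) :=
      (isLocalNormPair_iff_comp_of_corresponds L H v (UnitaryGroup.cmDatumLocalCongr L v T ha h).symm hcl γH b).1 hb
    rw [finExplicitDelta_of_isLocalNormPair L v _ γH μ hb₀, finExplicitDelta_of_isLocalNormPair L v H γH μ hb,
      finKappaAt_cmDatumLocalCongr_symm_of_split L v H T ha h hs γH b]
  · have hb₀ : ¬ IsLocalNormPair L (Matrix.of fun i j : Fin 3 => if i.val + j.val + 1 = 3 then (1 : L) else 0) v γH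
        ((UnitaryGroup.cmDatumLocalCongr L v T ha h).symm b) :=
      fun h0 => hb ((isLocalNormPair_iff_comp_of_corresponds L H v (UnitaryGroup.cmDatumLocalCongr L v T ha h).symm hcl γH b).2 h0)
    rw [finExplicitDelta_of_not_isLocalNormPair L v _ γH μ hb₀, finExplicitDelta_of_not_isLocalNormPair L v H γH μ hb]

/-! ## §4 The `Δ‴`-weighted orbital sums along the frame at a SPLIT place -/

section Sums

variable [∀ γ : (UnitaryGroup.cmDatum L 3 H).Local v,
    MeasurableSpace ((UnitaryGroup.cmDatum L 3 H).Local v ⧸ Subgroup.centralizer ({γ} : Set ((UnitaryGroup.cmDatum L 3 H).Local v)))]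
  [∀ γ : (UnitaryGroup.cmDatum L 3 H).Local v,
    BorelSpace ((UnitaryGroup.cmDatum L 3 H).Local v ⧸ Subgroup.centralizer ({γ} : Set ((UnitaryGroup.cmDatum L 3 H).Local v)))]
  [∀ γ : (UnitaryGroup.cmDatum L 3 (Matrix.of fun i j : Fin 3 => if i.val + j.val + 1 = 3 then (1 : L) else 0)).Local v,
    MeasurableSpace ((UnitaryGroup.cmDatum L 3 (Matrix.of fun i j : Fin 3 => if i.val + j.val + 1 = 3 then (1 : L) else 0)).Local v ⧸
      Subgroup.centralizer ({γ} : Set ((UnitaryGroup.cmDatum L 3 (Matrix.of fun i j : Fin 3 => if i.val + j.val + 1 = 3 then (1 : L) else 0)).Local v)))]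
  [∀ γ : (UnitaryGroup.cmDatum L 3 (Matrix.of fun i j : Fin 3 => if i.val + j.val + 1 = 3 then (1 : L) else 0)).Local v,
    BorelSpace ((UnitaryGroup.cmDatum L 3 (Matrix.of fun i j : Fin 3 => if i.val + j.val + 1 = 3 then (1 : L) else 0)).Local v ⧸
      Subgroup.centralizer ({γ} : Set ((UnitaryGroup.cmDatum L 3 (Matrix.of fun i j : Fin 3 => if i.val + j.val + 1 = 3 then (1 : L) else 0)).Local v)))]

open scoped Classical in
/-- **THE `Δ‴`-WEIGHTED ORBITAL SUMS TRANSPORT ALONG `e_v` WITHOUT SIGN AT A SPLIT PLACE**: for a family `m_G` of orbital measures on `U(H)_v`, a function `g` on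
`U(H)_v` and any `γ_H`, `Σᶠ_{c ∈ Cl U(Φ₃)_v} Δ‴_v^{Φ₃}(γ_H, out c)·Φ(c, g ∘ e_v; (e_v⁻¹)_* m_G) = Σᶠ_{c′ ∈ Cl U(H)_v} Δ‴_v^{H}(γ_H, out c′)·Φ(c′, g; m_G)` — reindex along
`c ↦ e_v(c)` (★ `preClass`), orbital integrals transport exactly (★ `classOrbitalIntegral_transport`), `Δ‴_v^{Φ₃}(γ_H, ·)` is a class function (★
`finExplicitDelta_conj_right_all`) and §3. [cite: Rogawski1990, §14.4 p. 237; §4.3 (4.3.1) p. 43] -/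
theorem finsum_finExplicitDelta_mul_classOrbitalIntegral_transport_of_split (hs : ∃ w : UnitaryGroup.PlacesOver L v, IsCMField.complexConj L • w.1 ≠ w.1)
    (μ : HeckeCharacter L) (mG : OrbitalMeasureFamily ((UnitaryGroup.cmDatum L 3 H).Local v)) (g : (UnitaryGroup.cmDatum L 3 H).Local v → ℂ)
    (γH : (UnitaryGroup.cmDatum L 2 (Matrix.of fun i j : Fin 2 => if i.val + j.val + 1 = 2 then (1 : L) else 0)).Local v ×
      (UnitaryGroup.cmDatum L 1 (Matrix.of fun i j : Fin 1 => if i.val + j.val + 1 = 1 then (1 : L) else 0)).Local v) :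
    (∑ᶠ c : ConjClasses ((UnitaryGroup.cmDatum L 3 (Matrix.of fun i j : Fin 3 => if i.val + j.val + 1 = 3 then (1 : L) else 0)).Local v),
        finExplicitDelta L v (Matrix.of fun i j : Fin 3 => if i.val + j.val + 1 = 3 then (1 : L) else 0) γH μ (Quotient.out c) *
          classOrbitalIntegral
            (mG.transport (UnitaryGroup.cmDatumLocalCongr L v T ha h).symm.toMulEquiv (UnitaryGroup.cmDatumLocalCongr L v T ha h).symm.continuous
              (UnitaryGroup.cmDatumLocalCongr L v T ha h).continuous)
            (g ∘ UnitaryGroup.cmDatumLocalCongr L v T ha h) c) =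
      ∑ᶠ c : ConjClasses ((UnitaryGroup.cmDatum L 3 H).Local v), finExplicitDelta L v H γH μ (Quotient.out c) * classOrbitalIntegral mG g c := by
  classical
  set ψ : (UnitaryGroup.cmDatum L 3 H).Local v ≃* (UnitaryGroup.cmDatum L 3 (Matrix.of fun i j : Fin 3 => if i.val + j.val + 1 = 3 then (1 : L) else 0)).Local v :=
    (UnitaryGroup.cmDatumLocalCongr L v T ha h).symm.toMulEquiv with hψ
  -- `c ↦ e_v(c)` is a bijection on conjugacy classes
  have hbij : Function.Bijective (fun c : ConjClasses ((UnitaryGroup.cmDatum L 3 (Matrix.of fun i j : Fin 3 => if i.val + j.val + 1 = 3 then (1 : L) else 0)).Local v) =>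
      preClass ψ c) := by
    refine ⟨fun c₁ c₂ h12 => ?_, fun c' => ⟨c'.map ψ.toMonoidHom, preClass_map ψ c'⟩⟩
    have h' : preClass ψ c₁ = preClass ψ c₂ := h12
    rw [← map_preClass ψ c₁, ← map_preClass ψ c₂, h']
  refine finsum_eq_of_bijective (fun c => preClass ψ c) hbij fun c => ?_
  -- orbital integrals transport exactly; `(g ∘ e_v) ∘ e_v⁻¹ = g`
  have hf : (g ∘ (UnitaryGroup.cmDatumLocalCongr L v T ha h)) ∘ ψ = g := by
    funext b
    show g ((UnitaryGroup.cmDatumLocalCongr L v T ha h) ((UnitaryGroup.cmDatumLocalCongr L v T ha h).symm b)) = g b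
    rw [ContinuousMulEquiv.apply_symm_apply]
  rw [classOrbitalIntegral_transport, hf]
  -- `Δ‴(γ_H, out c) = Δ‴(γ_H, e_v⁻¹ (out (e_v c)))` (conjugate) `= Δ‴^{H}(γ_H, out (e_v c))`
  obtain ⟨y, hy⟩ := isConj_iff.1 (isConj_apply_out_preClass ψ c)
  rw [← hy, finExplicitDelta_conj_right_all L (Matrix.of fun i j : Fin 3 => if i.val + j.val + 1 = 3 then (1 : L) else 0) μ v γH _ y,
    show ψ (Quotient.out (preClass ψ c)) = (UnitaryGroup.cmDatumLocalCongr L v T ha h).symm (Quotient.out (preClass ψ c)) from rfl,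
    finExplicitDelta_cmDatumLocalCongr_symm_of_split L v H T ha h hs μ γH]

end Sums

/-! ## §4b Homogeneity of the `Δ`-weighted orbital sums (generic) -/

/-- `Σᶠ_c Δ(γ_H, c)·Φ(c, z•f) = z · Σᶠ_c Δ(γ_H, c)·Φ(c, f)` (★ `classOrbitalIntegral_const_smul`, Mathlib `mul_finsum`). [cite: Rogawski1990, §4.3 (4.3.1) p. 43] -/
theorem finsum_delta_mul_classOrbitalIntegral_const_smul' {X : Matrix (Fin 3) (Fin 3) L}
    [∀ γ : (UnitaryGroup.cmDatum L 3 X).Local v, MeasurableSpace ((UnitaryGroup.cmDatum L 3 X).Local v ⧸ Subgroup.centralizer ({γ} : Set ((UnitaryGroup.cmDatum L 3 X).Local v)))]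
    (Δ : LocalTransferFactor L X v) (mG : OrbitalMeasureFamily ((UnitaryGroup.cmDatum L 3 X).Local v)) (z : ℂ) (f : (UnitaryGroup.cmDatum L 3 X).Local v → ℂ)
    (γH : (UnitaryGroup.cmDatum L 2 (Matrix.of fun i j : Fin 2 => if i.val + j.val + 1 = 2 then (1 : L) else 0)).Local v ×
      (UnitaryGroup.cmDatum L 1 (Matrix.of fun i j : Fin 1 => if i.val + j.val + 1 = 1 then (1 : L) else 0)).Local v) :
    (∑ᶠ c : ConjClasses ((UnitaryGroup.cmDatum L 3 X).Local v), Δ.Δ γH (Quotient.out c) * classOrbitalIntegral mG (z • f) c) =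
      z * ∑ᶠ c : ConjClasses ((UnitaryGroup.cmDatum L 3 X).Local v), Δ.Δ γH (Quotient.out c) * classOrbitalIntegral mG f c := by
  rw [mul_finsum]
  exact finsum_congr fun c => by rw [classOrbitalIntegral_const_smul, mul_left_comm]

/-! ## §5 (R-i) AT A SPLIT PLACE: matchings transport along the frame with sign `+1` -/

section Transfer

variable [∀ γH : (UnitaryGroup.cmDatum L 2 (Matrix.of fun i j : Fin 2 => if i.val + j.val + 1 = 2 then (1 : L) else 0)).Local v ×
      (UnitaryGroup.cmDatum L 1 (Matrix.of fun i j : Fin 1 => if i.val + j.val + 1 = 1 then (1 : L) else 0)).Local v,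
    MeasurableSpace (((UnitaryGroup.cmDatum L 2 (Matrix.of fun i j : Fin 2 => if i.val + j.val + 1 = 2 then (1 : L) else 0)).Local v ×
      (UnitaryGroup.cmDatum L 1 (Matrix.of fun i j : Fin 1 => if i.val + j.val + 1 = 1 then (1 : L) else 0)).Local v) ⧸
      Subgroup.centralizer ({γH} : Set ((UnitaryGroup.cmDatum L 2 (Matrix.of fun i j : Fin 2 => if i.val + j.val + 1 = 2 then (1 : L) else 0)).Local v ×
      (UnitaryGroup.cmDatum L 1 (Matrix.of fun i j : Fin 1 => if i.val + j.val + 1 = 1 then (1 : L) else 0)).Local v)))]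
  [∀ γ : (UnitaryGroup.cmDatum L 3 H).Local v,
    MeasurableSpace ((UnitaryGroup.cmDatum L 3 H).Local v ⧸ Subgroup.centralizer ({γ} : Set ((UnitaryGroup.cmDatum L 3 H).Local v)))]
  [∀ γ : (UnitaryGroup.cmDatum L 3 H).Local v,
    BorelSpace ((UnitaryGroup.cmDatum L 3 H).Local v ⧸ Subgroup.centralizer ({γ} : Set ((UnitaryGroup.cmDatum L 3 H).Local v)))]
  [∀ γ : (UnitaryGroup.cmDatum L 3 (Matrix.of fun i j : Fin 3 => if i.val + j.val + 1 = 3 then (1 : L) else 0)).Local v,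
    MeasurableSpace ((UnitaryGroup.cmDatum L 3 (Matrix.of fun i j : Fin 3 => if i.val + j.val + 1 = 3 then (1 : L) else 0)).Local v ⧸
      Subgroup.centralizer ({γ} : Set ((UnitaryGroup.cmDatum L 3 (Matrix.of fun i j : Fin 3 => if i.val + j.val + 1 = 3 then (1 : L) else 0)).Local v)))]
  [∀ γ : (UnitaryGroup.cmDatum L 3 (Matrix.of fun i j : Fin 3 => if i.val + j.val + 1 = 3 then (1 : L) else 0)).Local v,
    BorelSpace ((UnitaryGroup.cmDatum L 3 (Matrix.of fun i j : Fin 3 => if i.val + j.val + 1 = 3 then (1 : L) else 0)).Local v ⧸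
      Subgroup.centralizer ({γ} : Set ((UnitaryGroup.cmDatum L 3 (Matrix.of fun i j : Fin 3 => if i.val + j.val + 1 = 3 then (1 : L) else 0)).Local v)))]

open scoped Classical in
/-- **(R-i) — (4.9.1)-MATCHINGS TRANSPORT ALONG `e_v` AT A SPLIT PLACE, SIGN `+1`** [§14.4 p. 237; (4.3.1)–(4.3.2) p. 43; §4.9 p. 55]: for the explicit factors of record
`Δ‴_v^{H}`, `Δ‴_v^{Φ₃}` (★ `finExplicitCollection`), a family `m′_G` on `U(H)_v`, the frame `e_v = cmDatumLocalCongr L v T ha h : U(Φ₃)_v ≃ₜ* U(H)_v` and a place `v` of `L⁺`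
SPLIT in `L`: `(f^H, g)` is `Δ‴^{H}`-matched for `(m_H, m′_G)` iff `(f^H, g ∘ e_v)` is `Δ‴^{Φ₃}`-matched for `(m_H, (e_v⁻¹)_* m′_G)` — both say
`Φ^st(γ_H, f^H) = Σᶠ_{c′} Δ‴^{H}(γ_H, c′)·Φ(c′, g)` at every `G`-regular `γ_H` (§4; at a split place `κ_v ≡ 1`, no sign). [cite: Rogawski1990, §14.4 p. 237; §4.3 (4.3.1) p. 43; §4.9 p. 55; §14.6 p. 242] -/
theorem isLocalDeltaTransfer_finExplicit_transport_iff_of_split (hs : ∃ w : UnitaryGroup.PlacesOver L v, IsCMField.complexConj L • w.1 ≠ w.1) (μ : HeckeCharacter L)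
    (mH : OrbitalMeasureFamily ((UnitaryGroup.cmDatum L 2 (Matrix.of fun i j : Fin 2 => if i.val + j.val + 1 = 2 then (1 : L) else 0)).Local v ×
      (UnitaryGroup.cmDatum L 1 (Matrix.of fun i j : Fin 1 => if i.val + j.val + 1 = 1 then (1 : L) else 0)).Local v))
    (mG : OrbitalMeasureFamily ((UnitaryGroup.cmDatum L 3 H).Local v))
    (fH : (UnitaryGroup.cmDatum L 2 (Matrix.of fun i j : Fin 2 => if i.val + j.val + 1 = 2 then (1 : L) else 0)).Local v ×
      (UnitaryGroup.cmDatum L 1 (Matrix.of fun i j : Fin 1 => if i.val + j.val + 1 = 1 then (1 : L) else 0)).Local v → ℂ)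
    (g : (UnitaryGroup.cmDatum L 3 H).Local v → ℂ) :
    IsLocalDeltaTransfer L H v (finExplicitCollection L H μ (finExplicitDelta_conj_left_all L H μ) (finExplicitDelta_conj_right_all L H μ) v) mH mG fH g ↔
      IsLocalDeltaTransfer L (Matrix.of fun i j : Fin 3 => if i.val + j.val + 1 = 3 then (1 : L) else 0) v
        (finExplicitCollection L (Matrix.of fun i j : Fin 3 => if i.val + j.val + 1 = 3 then (1 : L) else 0) μ
          (finExplicitDelta_conj_left_all L _ μ) (finExplicitDelta_conj_right_all L _ μ) v) mH
        (mG.transport (UnitaryGroup.cmDatumLocalCongr L v T ha h).symm.toMulEquiv (UnitaryGroup.cmDatumLocalCongr L v T ha h).symm.continuous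
          (UnitaryGroup.cmDatumLocalCongr L v T ha h).continuous) fH (g ∘ UnitaryGroup.cmDatumLocalCongr L v T ha h) := by
  refine forall₂_congr fun γH _ => ?_
  have key : (∑ᶠ c : ConjClasses ((UnitaryGroup.cmDatum L 3 (Matrix.of fun i j : Fin 3 => if i.val + j.val + 1 = 3 then (1 : L) else 0)).Local v),
      (finExplicitCollection L (Matrix.of fun i j : Fin 3 => if i.val + j.val + 1 = 3 then (1 : L) else 0) μ
          (finExplicitDelta_conj_left_all L _ μ) (finExplicitDelta_conj_right_all L _ μ) v).Δ γH (Quotient.out c) *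
        classOrbitalIntegral
          (mG.transport (UnitaryGroup.cmDatumLocalCongr L v T ha h).symm.toMulEquiv (UnitaryGroup.cmDatumLocalCongr L v T ha h).symm.continuous
            (UnitaryGroup.cmDatumLocalCongr L v T ha h).continuous)
          (g ∘ UnitaryGroup.cmDatumLocalCongr L v T ha h) c) =
      ∑ᶠ c : ConjClasses ((UnitaryGroup.cmDatum L 3 H).Local v),
        (finExplicitCollection L H μ (finExplicitDelta_conj_left_all L H μ) (finExplicitDelta_conj_right_all L H μ) v).Δ γH (Quotient.out c) *
          classOrbitalIntegral mG g c :=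
    finsum_finExplicitDelta_mul_classOrbitalIntegral_transport_of_split L v H T ha h hs μ mG g γH
  rw [key]

/-- **(R-i), ONE-WAY FORM — the `htr` input of `Lines/R90_S3_CharIdTransportB` ED. 2 §5 BY SHAPE** (record factors on both sides, frame of record, sign `+1`): at a
place `v` of `L⁺` SPLIT in `L`, a `Δ‴^{H}`-matched pair `(f^H, g)` on `(H_v, U(H)_v)` gives the `Δ‴^{Φ₃}`-matched pair `(f^H, g ∘ e_v)` on `(H_v, U(Φ₃)_v)` for the
transported family `(e_v⁻¹)_* m′_G`.  (Smoothness of `f^H`, `g` is not needed; consumers may weaken.) [cite: Rogawski1990, §14.4 p. 237; §4.3 (4.3.1) p. 43; §4.9 p. 55] -/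
theorem isLocalDeltaTransfer_finExplicit_transport_of_split (hs : ∃ w : UnitaryGroup.PlacesOver L v, IsCMField.complexConj L • w.1 ≠ w.1) (μ : HeckeCharacter L)
    (mH : OrbitalMeasureFamily ((UnitaryGroup.cmDatum L 2 (Matrix.of fun i j : Fin 2 => if i.val + j.val + 1 = 2 then (1 : L) else 0)).Local v ×
      (UnitaryGroup.cmDatum L 1 (Matrix.of fun i j : Fin 1 => if i.val + j.val + 1 = 1 then (1 : L) else 0)).Local v))
    (mG : OrbitalMeasureFamily ((UnitaryGroup.cmDatum L 3 H).Local v))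
    (fH : (UnitaryGroup.cmDatum L 2 (Matrix.of fun i j : Fin 2 => if i.val + j.val + 1 = 2 then (1 : L) else 0)).Local v ×
      (UnitaryGroup.cmDatum L 1 (Matrix.of fun i j : Fin 1 => if i.val + j.val + 1 = 1 then (1 : L) else 0)).Local v → ℂ)
    (g : (UnitaryGroup.cmDatum L 3 H).Local v → ℂ)
    (ht : IsLocalDeltaTransfer L H v (finExplicitCollection L H μ (finExplicitDelta_conj_left_all L H μ) (finExplicitDelta_conj_right_all L H μ) v) mH mG fH g) :
    IsLocalDeltaTransfer L (Matrix.of fun i j : Fin 3 => if i.val + j.val + 1 = 3 then (1 : L) else 0) v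
      (finExplicitCollection L (Matrix.of fun i j : Fin 3 => if i.val + j.val + 1 = 3 then (1 : L) else 0) μ
        (finExplicitDelta_conj_left_all L _ μ) (finExplicitDelta_conj_right_all L _ μ) v) mH
      (mG.transport (UnitaryGroup.cmDatumLocalCongr L v T ha h).symm.toMulEquiv (UnitaryGroup.cmDatumLocalCongr L v T ha h).symm.continuous
        (UnitaryGroup.cmDatumLocalCongr L v T ha h).continuous) fH (g ∘ UnitaryGroup.cmDatumLocalCongr L v T ha h) :=
  (isLocalDeltaTransfer_finExplicit_transport_iff_of_split L v H T ha h hs μ mH mG fH g).1 ht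

/-! ## §6 EVERY FINITE PLACE, NO GUARD: the sign is the form sign `ε_v(H) = formSignAt L c H v` -/

/-- **(4.9.1)-MATCHINGS TRANSPORT ALONG `e_v` WITH THE FORM SIGN `ε_v(H)`, AT EVERY FINITE PLACE** [§14.4 p. 237; (14.6.3) p. 242]: for `H` hermitian with
`det H` a unit, the factors of record `Δ‴_v^{H}`, `Δ‴_v^{Φ₃}`, a family `m′_G` on `U(H)_v` and the frame `e_v = cmDatumLocalCongr L v T ha h`: `(f^H, g)` is
`Δ‴^{H}`-matched for `(m_H, m′_G)` iff `(f^H, ε_v(H)·(g ∘ e_v))` is `Δ‴^{Φ₃}`-matched for `(m_H, (e_v⁻¹)_* m′_G)`, `ε_v(H) = formSignAt L c H v ∈ {±1}` — at a non-split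
`v` this is the frame sign `χ(a)` of ★ `finsum_finExplicitDelta_mul_classOrbitalIntegral_transport` read through ★ `clauseSign_eq_intCast_formSignAt`; at a split `v`
the sign is `1` (★ `intCast_formSignAt_eq_one_of_split`) and §5 applies.  ONE statement for split and non-split places (AUDIT S3#12 (R-i)).
[cite: Rogawski1990, §14.4 p. 237; §14.6 (14.6.3) p. 242; §4.3 (4.3.1) p. 43; §4.9 p. 55] [cite: LanglandsShelstad1987, §4.2] -/
theorem isLocalDeltaTransfer_finExplicit_transport_iff_formSignAt (hH : (H.map (cmConjRingHom L))ᵀ = H) (hHd : IsUnit H.det) (μ : HeckeCharacter L)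
    (mH : OrbitalMeasureFamily ((UnitaryGroup.cmDatum L 2 (Matrix.of fun i j : Fin 2 => if i.val + j.val + 1 = 2 then (1 : L) else 0)).Local v ×
      (UnitaryGroup.cmDatum L 1 (Matrix.of fun i j : Fin 1 => if i.val + j.val + 1 = 1 then (1 : L) else 0)).Local v))
    (mG : OrbitalMeasureFamily ((UnitaryGroup.cmDatum L 3 H).Local v))
    (fH : (UnitaryGroup.cmDatum L 2 (Matrix.of fun i j : Fin 2 => if i.val + j.val + 1 = 2 then (1 : L) else 0)).Local v ×
      (UnitaryGroup.cmDatum L 1 (Matrix.of fun i j : Fin 1 => if i.val + j.val + 1 = 1 then (1 : L) else 0)).Local v → ℂ)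
    (g : (UnitaryGroup.cmDatum L 3 H).Local v → ℂ) :
    IsLocalDeltaTransfer L H v (finExplicitCollection L H μ (finExplicitDelta_conj_left_all L H μ) (finExplicitDelta_conj_right_all L H μ) v) mH mG fH g ↔
      IsLocalDeltaTransfer L (Matrix.of fun i j : Fin 3 => if i.val + j.val + 1 = 3 then (1 : L) else 0) v
        (finExplicitCollection L (Matrix.of fun i j : Fin 3 => if i.val + j.val + 1 = 3 then (1 : L) else 0) μ
          (finExplicitDelta_conj_left_all L _ μ) (finExplicitDelta_conj_right_all L _ μ) v) mH
        (mG.transport (UnitaryGroup.cmDatumLocalCongr L v T ha h).symm.toMulEquiv (UnitaryGroup.cmDatumLocalCongr L v T ha h).symm.continuous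
          (UnitaryGroup.cmDatumLocalCongr L v T ha h).continuous) fH
        (((formSignAt L (IsCMField.complexConj L) H v : ℤ) : ℂ) • (g ∘ UnitaryGroup.cmDatumLocalCongr L v T ha h)) := by
  classical
  by_cases hs : ∃ w : UnitaryGroup.PlacesOver L v, IsCMField.complexConj L • w.1 ≠ w.1
  · -- split place: sign `1`, §5
    rw [intCast_formSignAt_eq_one_of_split L H v hs, one_smul]
    exact isLocalDeltaTransfer_finExplicit_transport_iff_of_split L v H T ha h hs μ mH mG fH g
  · -- non-split place: the frame sign `χ(a)` IS the form sign
    have hv : ∀ w : UnitaryGroup.PlacesOver L v, IsCMField.complexConj L • w.1 = w.1 := fun w => by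
      by_contra hw
      exact hs ⟨w, hw⟩
    obtain ⟨w⟩ := UnitaryGroup.PlacesOver.nonempty L v
    have hw := hv w
    have haσ : UnitaryGroup.conjLocal L (IsCMField.complexConj L) v a = a :=
      conjLocal_eq_self_of_formCongr_eq_smul_antidiag L (by norm_num) hH v T h
    have hsign : (((if ∃ z : UnitaryGroup.LocalRing L v, IsUnit z ∧ a = z * UnitaryGroup.conjLocal L (IsCMField.complexConj L) v z then (1 : ℤ) else -1 : ℤ) : ℂ)) =
        ((formSignAt L (IsCMField.complexConj L) H v : ℤ) : ℂ) := by
      rw [← clauseSign_eq_intCast_formSignAt L H hH v hv T a ha h]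
      split_ifs <;> simp
    have hε2 : ((formSignAt L (IsCMField.complexConj L) H v : ℤ) : ℂ) * ((formSignAt L (IsCMField.complexConj L) H v : ℤ) : ℂ) = 1 :=
      intCast_formSignAt_mul_self L H v
    refine forall₂_congr fun γH hreg => ?_
    have hu := isUnit_eval_finCharpolyTwo_of_isLocalGRegular L v γH hreg
    have key : (∑ᶠ c : ConjClasses ((UnitaryGroup.cmDatum L 3 (Matrix.of fun i j : Fin 3 => if i.val + j.val + 1 = 3 then (1 : L) else 0)).Local v),
        (finExplicitCollection L (Matrix.of fun i j : Fin 3 => if i.val + j.val + 1 = 3 then (1 : L) else 0) μ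
            (finExplicitDelta_conj_left_all L _ μ) (finExplicitDelta_conj_right_all L _ μ) v).Δ γH (Quotient.out c) *
          classOrbitalIntegral
            (mG.transport (UnitaryGroup.cmDatumLocalCongr L v T ha h).symm.toMulEquiv (UnitaryGroup.cmDatumLocalCongr L v T ha h).symm.continuous
              (UnitaryGroup.cmDatumLocalCongr L v T ha h).continuous)
            (g ∘ UnitaryGroup.cmDatumLocalCongr L v T ha h) c) =
        ((formSignAt L (IsCMField.complexConj L) H v : ℤ) : ℂ) * ∑ᶠ c : ConjClasses ((UnitaryGroup.cmDatum L 3 H).Local v),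
          (finExplicitCollection L H μ (finExplicitDelta_conj_left_all L H μ) (finExplicitDelta_conj_right_all L H μ) v).Δ γH (Quotient.out c) *
            classOrbitalIntegral mG g c := by
      rw [← hsign]
      exact finsum_finExplicitDelta_mul_classOrbitalIntegral_transport L v H T ha h w hw hH hHd.ne_zero haσ μ mG g γH hu
    rw [finsum_delta_mul_classOrbitalIntegral_const_smul', key, ← mul_assoc, hε2, one_mul]

end Transfer

end Summit.HodgeConjecture.HodgeConjecture.R90.S3

end
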